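import Summits.QuantumFields.BalabanUV.Beta.GAN24.ExchangeFieldLegs
import Summits.QuantumFields.BalabanUV.Beta.GAN24.ExchangeSlotFubini

/-!
# (C)sym at level 0 — the LITERAL EE integrand resummed over its second bond: `ExchangeSlotFubini` applied to the dressed source
# (blueprint §6 (L1), steps 3–4 of the outer Fubini)

WHAT. For a fixed first bond `(μ, u)`, the literal two-face-read EE integrand `Σ'_{(y,w)} 𝟙f(y_α)𝟙f(w_β)·((V_{μ,u} ∘ X̃♮_j) ∘ V_{ν,u′}) y w (inl α)(inl β)`
(`V_{κ,v} = vertexOfK X̃♮_j Lc S^E κ v`, `X̃♮_j = unitK s_f s_m (coDressKBmAt ρ Lc (KInvStep Lc j))`, `S^E = unitS s_f s_m (cE • wilsonA)`, in-block root, `1 ≤ Lc`, all units)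
is, on field legs (`ExchangeFieldLegs.comp_comp_vertex_wilson_inl_inl`), `Σ'_{(y,w)} 𝟙f 𝟙f·Σ'_z Σ_b A_b(y,z)·Q_b(u′,z,w)` with the LEFT FACTOR
`A_b(y,z) = Σ'_{y₁} Σ_a V_{μ,u} y y₁ (inl α)(inl a)·X̃♮_j y₁ z (inl a)(inl b)` bi-localised at `(Lc•u, Lc•u)` (an2's `biLoc_comp_right` — `V_{μ,u}` is a `VertexFamily`
member, `X̃♮_j` decays) and the RIGHT FACTOR `Q_b(u′,z,w) = V_{ν,u′} z w (inl b)(inl β)` bi-localised at `(Lc•u′, Lc•u′)`; so `ExchangeSlotFubini.hasSum_slot_resum` applies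
per field leg `b`:

* §1 `abs_leftFactor_le` (the bi-localisation of `A_b`), `summable_leftFactor_mul` (`z ↦ A_b(y,z)·Q_b(u′,z,w)` is summable);
* §2 **`hasSum_literal_slot`**: `HasSum (u′ ↦ Σ'_{(y,w)} 𝟙f(y_α)𝟙f(w_β)·((V_{μ,u} ∘ X̃♮_j) ∘ V_{ν,u′}) y w (inl α)(inl β))
  (Σ_b Σ'_{(y,z)} 𝟙f(y_α)·A_b(y,z)·Σ'_{(u′,w)} 𝟙f(w_β)·Q_b(u′,z,w))` — the second bond RESUMMED INSIDE against the right half-vertex, for every level `j`.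

With `ExchangeFieldLegs.tsum_prod_faceHalfVertex` the inner `Σ'_{(u′,w)}` is the nested `Σ'_{u′} Σ'_w` of `DressedWilsonHalfVertex.hasSum_faceHalfVertex_snd` (`= K₁·(+½·curvAdj F_{νβ} b z)` at
`j = 0`), so what is left of blueprint §6 (L1) after this file is ONLY the three-fold Fubini `(y,z) ▸ y₁ ↔ y₁ ▸ y ▸ z` against that bounded block-periodic current — then
`EEWordReduced.ee_word_reduced′` gives `ee_word_value` v2 (sketch `HOME/…/g65/Sketch_L1_OuterFubini.concat.sorried.NOT-TO-FILE.lean`).  NOT done here.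

HONEST: [folklore] `tsum` bookkeeping BY NAME over this lineage's `ExchangeSlotFubini` ∕ `ExchangeFieldLegs` and an2's `biLoc_comp_right` ∕ `vertexFamily_vertexOfK`; no value of
Bałaban's tables beyond an3's DEFINED stencil is asserted; (C)sym stays DISPLAYED — nothing of (C)∕(Q-D)∕(Q-D-rate) is discharged; NEVER «G-an2-4 closed» as (CONV-C); NOT D1,
NOT BetaPertH, NOT continuum, NOT Clay.
-/

noncomputable section

open Finset
open scoped BigOperators
open Literature.MathematicalPhysics.QuantumFieldTheory
open Literature.MathematicalPhysics.QuantumFieldTheory.Balaban1983to89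
open Literature.MathematicalPhysics.QuantumFieldTheory.Balaban1983to89.Beta
open B12Sec2to5 (l1 l1_nonneg)
open ExpKernelCalculus (Site MKer comp Decays BiLoc VertexFamily summable_exp_shift')
open OneStepResolventKernel (Fib LocStencil decays_mono biLoc_mono)
open BalabanStepJetsSucc (biLoc_comp_right)
open OneStepKernelFamily (KInvStep vertexOfK vertexFamily_vertexOfK decays_KInvStep)
open StepJetData (wilsonA locStencil_wilsonA locStencil_smul)
open AffineAveraging (box toSite)
open Summit.QuantumFields.BalabanUV.Beta.AxialDressingRooted (coDressKBmAt decays_coDressKBmAt)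
open Summit.QuantumFields.BalabanUV.Beta.HessKerDressedUnits (unitK unitS decays_unitK locStencil_unitS)
open Summit.QuantumFields.BalabanUV.Beta.GAN24.ExchangeFieldLegs (vertexOfK_wilson_inl_inr comp_comp_vertex_wilson_inl_inl)
open Summit.QuantumFields.BalabanUV.Beta.GAN24.ExchangeSlotFubini (summable_slot_family hasSum_slot_resum)

namespace Summit.QuantumFields.BalabanUV.Beta.GAN24.ExchangeSlotLiteral

variable {d : ℕ} {Lc : ℕ} [NeZero Lc] {r : Fin (d + 1) → ℕ} {μ ν α β : Fin (d + 1)}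

/-- [folklore] **DECAY DATA OF THE DRESSED SOURCE** (in-block root, `1 ≤ Lc`, level `j`, all units): a rate `δ > 0` and constants with the chain-rule vertex a `VertexFamily`
at rate `δ` and the left factor `(V_{μ,u} ∘ X̃♮_j)` bi-localised at `(Lc•u, Lc•u)` at rate `δ` (`decays_coDressKBmAt` ⨾ `decays_unitK` ⨾ `locStencil_wilsonA` ⨾ `locStencil_unitS` ⨾
`vertexFamily_vertexOfK` ⨾ `biLoc_comp_right`, rates matched by halving). -/
theorem exists_decay_data (hLc : 1 ≤ Lc) (hr : r ∈ box (d + 1) Lc) (sf sm cE : ℝ) (j : ℕ) (μ : Fin (d + 1)) (u : Site (d + 1)) :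
    ∃ δ Cv C2 : ℝ, 0 < δ ∧ 0 ≤ Cv ∧ 0 ≤ C2 ∧
      VertexFamily (vertexOfK (unitK sf sm (coDressKBmAt (toSite r) Lc (KInvStep (d := d) Lc j))) Lc (unitS sf sm (fun κ v => cE • wilsonA d κ v))) Lc Cv δ ∧
      BiLoc (comp (vertexOfK (unitK sf sm (coDressKBmAt (toSite r) Lc (KInvStep (d := d) Lc j))) Lc (unitS sf sm (fun κ v => cE • wilsonA d κ v)) μ u) (unitK sf sm (coDressKBmAt (toSite r) Lc (KInvStep (d := d) Lc j)))) ((Lc : ℤ) • u) ((Lc : ℤ) • u) C2 δ := by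
  obtain ⟨δK, CK, hδK, hCK, hXd⟩ := decays_coDressKBmAt hLc hr (decays_KInvStep (d := d) (Lc := Lc) j)
  have hXu := decays_unitK (sf := sf) (sm := sm) hXd
  have hS := locStencil_unitS (sf := sf) (sm := sm) (locStencil_smul cE (locStencil_wilsonA (d := d) hδK.le))
  have hC : 0 ≤ max |sf| |sm| * CK * max |sf| |sm| := by positivity
  obtain ⟨Cv, hVF⟩ : ∃ Cv : ℝ, VertexFamily (vertexOfK (unitK sf sm (coDressKBmAt (toSite r) Lc (KInvStep (d := d) Lc j))) Lc (unitS sf sm (fun κ v => cE • wilsonA d κ v))) Lc Cv (δK / 2) :=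
    ⟨_, vertexFamily_vertexOfK (N := Lc) hXu hC hS hδK le_rfl⟩
  have hCv : 0 ≤ Cv := (hVF μ 0).nonneg (Sum.inl 0)
  have hXu' : Decays (unitK sf sm (coDressKBmAt (toSite r) Lc (KInvStep (d := d) Lc j))) (max |sf| |sm| * CK * max |sf| |sm|) (δK / 2) := decays_mono hXu hC le_rfl (by linarith)
  obtain ⟨C2, hVX⟩ : ∃ C2 : ℝ, BiLoc (comp (vertexOfK (unitK sf sm (coDressKBmAt (toSite r) Lc (KInvStep (d := d) Lc j))) Lc (unitS sf sm (fun κ v => cE • wilsonA d κ v)) μ u) (unitK sf sm (coDressKBmAt (toSite r) Lc (KInvStep (d := d) Lc j)))) ((Lc : ℤ) • u) ((Lc : ℤ) • u) C2 (δK / 4) :=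
    ⟨_, biLoc_comp_right (hVF μ u) hXu' (by positivity) (by linarith)⟩
  have hC2 : 0 ≤ C2 := hVX.nonneg (Sum.inl 0)
  exact ⟨δK / 4, Cv, C2, by positivity, hCv, hC2, fun κ v => biLoc_mono (hVF κ v) hCv (by linarith), hVX⟩

/-- [folklore] The left factor per field leg `b` IS the ff block of the composition `(V_{μ,u} ∘ X̃♮_j)` (the `inr` half of the middle fibre sum vanishes,
`ExchangeFieldLegs.vertexOfK_wilson_inl_inr`). -/
theorem comp_vertex_inl_inl (sf sm cE : ℝ) (j : ℕ) (u y z : Site (d + 1)) (b : Fin (d + 1)) :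
    comp (vertexOfK (unitK sf sm (coDressKBmAt (toSite r) Lc (KInvStep (d := d) Lc j))) Lc (unitS sf sm (fun κ v => cE • wilsonA d κ v)) μ u) (unitK sf sm (coDressKBmAt (toSite r) Lc (KInvStep (d := d) Lc j))) y z (Sum.inl α) (Sum.inl b) = (∑' y₁ : Site (d + 1), ∑ a : Fin (d + 1), vertexOfK (unitK sf sm (coDressKBmAt (toSite r) Lc (KInvStep (d := d) Lc j))) Lc (unitS sf sm (fun κ v => cE • wilsonA d κ v)) μ u y y₁ (Sum.inl α) (Sum.inl a) * unitK sf sm (coDressKBmAt (toSite r) Lc (KInvStep (d := d) Lc j)) y₁ z (Sum.inl a) (Sum.inl b)) := by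
  simp only [comp, Fintype.sum_sum_type, vertexOfK_wilson_inl_inr, zero_mul, Finset.sum_const_zero, add_zero]

/-- [folklore] **THE INTEGRAND ON FIELD LEGS WITH THE LEG SUM OUTSIDE** (in-block root, `1 ≤ Lc`, level `j`): for every second bond `u′`,
`Σ'_{(y,w)} 𝟙f 𝟙f·((V_{μ,u} ∘ X̃♮_j) ∘ V_{ν,u′}) y w (inl α)(inl β) = Σ_b Σ'_{(y,w)} 𝟙f 𝟙f·Σ'_z A_b(y,z)·V_{ν,u′} z w (inl b)(inl β)` — the two interchanges of the finite
leg sum with the `z`- and `(y,w)`-sums are licensed by the decay data (`ExchangeSlotFubini.summable_slot_family`). -/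
theorem tsum_integrand_eq (hLc : 1 ≤ Lc) (hr : r ∈ box (d + 1) Lc) (sf sm cE : ℝ) (j : ℕ) (u u' : Site (d + 1)) :
    (∑' yw : Site (d + 1) × Site (d + 1), (if yw.1 α % (Lc : ℤ) = (Lc : ℤ) - 1 then (1 : ℝ) else 0) * (if yw.2 β % (Lc : ℤ) = (Lc : ℤ) - 1 then (1 : ℝ) else 0) *
        comp (comp (vertexOfK (unitK sf sm (coDressKBmAt (toSite r) Lc (KInvStep (d := d) Lc j))) Lc (unitS sf sm (fun κ v => cE • wilsonA d κ v)) μ u) (unitK sf sm (coDressKBmAt (toSite r) Lc (KInvStep (d := d) Lc j)))) (vertexOfK (unitK sf sm (coDressKBmAt (toSite r) Lc (KInvStep (d := d) Lc j))) Lc (unitS sf sm (fun κ v => cE • wilsonA d κ v)) ν u') yw.1 yw.2 (Sum.inl α) (Sum.inl β)) =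
      ∑ b : Fin (d + 1), ∑' yw : Site (d + 1) × Site (d + 1), (if yw.1 α % (Lc : ℤ) = (Lc : ℤ) - 1 then (1 : ℝ) else 0) * (if yw.2 β % (Lc : ℤ) = (Lc : ℤ) - 1 then (1 : ℝ) else 0) *
        ∑' z : Site (d + 1), (∑' y₁ : Site (d + 1), ∑ a : Fin (d + 1), vertexOfK (unitK sf sm (coDressKBmAt (toSite r) Lc (KInvStep (d := d) Lc j))) Lc (unitS sf sm (fun κ v => cE • wilsonA d κ v)) μ u yw.1 y₁ (Sum.inl α) (Sum.inl a) * unitK sf sm (coDressKBmAt (toSite r) Lc (KInvStep (d := d) Lc j)) y₁ z (Sum.inl a) (Sum.inl b)) * vertexOfK (unitK sf sm (coDressKBmAt (toSite r) Lc (KInvStep (d := d) Lc j))) Lc (unitS sf sm (fun κ v => cE • wilsonA d κ v)) ν u' z yw.2 (Sum.inl b) (Sum.inl β) := by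
  classical
  obtain ⟨δ, Cv, C2, hδ, hCv, hC2, hVF, hVX⟩ := exists_decay_data (d := d) hLc hr sf sm cE j μ u
  have hAb : ∀ (b : Fin (d + 1)) (y z : Site (d + 1)), |(∑' y₁ : Site (d + 1), ∑ a : Fin (d + 1), vertexOfK (unitK sf sm (coDressKBmAt (toSite r) Lc (KInvStep (d := d) Lc j))) Lc (unitS sf sm (fun κ v => cE • wilsonA d κ v)) μ u y y₁ (Sum.inl α) (Sum.inl a) * unitK sf sm (coDressKBmAt (toSite r) Lc (KInvStep (d := d) Lc j)) y₁ z (Sum.inl a) (Sum.inl b))| ≤ C2 * Real.exp (-δ * (l1 (y - (Lc : ℤ) • u) + l1 (z - (Lc : ℤ) • u))) := by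
    intro b y z
    rw [← comp_vertex_inl_inl]
    exact hVX y z (Sum.inl α) (Sum.inl b)
  have hQb : ∀ (b : Fin (d + 1)) (u' z w : Site (d + 1)), |vertexOfK (unitK sf sm (coDressKBmAt (toSite r) Lc (KInvStep (d := d) Lc j))) Lc (unitS sf sm (fun κ v => cE • wilsonA d κ v)) ν u' z w (Sum.inl b) (Sum.inl β)| ≤
      Cv * Real.exp (-δ * (l1 (z - (Lc : ℤ) • u') + l1 (w - (Lc : ℤ) • u'))) := fun b u' z w => hVF ν u' z w (Sum.inl b) (Sum.inl β)
  have h₁ : ∀ y : Site (d + 1), |(if y α % (Lc : ℤ) = (Lc : ℤ) - 1 then (1 : ℝ) else 0)| ≤ 1 := fun y => by split_ifs <;> simp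
  have h₂ : ∀ w : Site (d + 1), |(if w β % (Lc : ℤ) = (Lc : ℤ) - 1 then (1 : ℝ) else 0)| ≤ 1 := fun w => by split_ifs <;> simp
  have hz : ∀ (b : Fin (d + 1)) (y w : Site (d + 1)), Summable fun z : Site (d + 1) => (∑' y₁ : Site (d + 1), ∑ a : Fin (d + 1), vertexOfK (unitK sf sm (coDressKBmAt (toSite r) Lc (KInvStep (d := d) Lc j))) Lc (unitS sf sm (fun κ v => cE • wilsonA d κ v)) μ u y y₁ (Sum.inl α) (Sum.inl a) * unitK sf sm (coDressKBmAt (toSite r) Lc (KInvStep (d := d) Lc j)) y₁ z (Sum.inl a) (Sum.inl b)) * vertexOfK (unitK sf sm (coDressKBmAt (toSite r) Lc (KInvStep (d := d) Lc j))) Lc (unitS sf sm (fun κ v => cE • wilsonA d κ v)) ν u' z w (Sum.inl b) (Sum.inl β) := by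
    intro b y w
    refine Summable.of_norm_bounded ((((summable_exp_shift' hδ ((Lc : ℤ) • u)).mul_left (C2 * Real.exp (-δ * l1 (y - (Lc : ℤ) • u)))).mul_right Cv)) (fun z => ?_)
    rw [Real.norm_eq_abs, abs_mul]
    have hA' := hAb b y z
    rw [mul_add, Real.exp_add, ← mul_assoc] at hA'
    have hQ' : |vertexOfK (unitK sf sm (coDressKBmAt (toSite r) Lc (KInvStep (d := d) Lc j))) Lc (unitS sf sm (fun κ v => cE • wilsonA d κ v)) ν u' z w (Sum.inl b) (Sum.inl β)| ≤ Cv :=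
      (hQb b u' z w).trans (mul_le_of_le_one_right hCv (Real.exp_le_one_iff.2 (by nlinarith [l1_nonneg (z - (Lc : ℤ) • u'), l1_nonneg (w - (Lc : ℤ) • u')])))
    exact mul_le_mul hA' hQ' (abs_nonneg _) (by positivity)
  have hyw : ∀ b : Fin (d + 1), Summable fun yw : Site (d + 1) × Site (d + 1) => (if yw.1 α % (Lc : ℤ) = (Lc : ℤ) - 1 then (1 : ℝ) else 0) * (if yw.2 β % (Lc : ℤ) = (Lc : ℤ) - 1 then (1 : ℝ) else 0) *
      ∑' z : Site (d + 1), (∑' y₁ : Site (d + 1), ∑ a : Fin (d + 1), vertexOfK (unitK sf sm (coDressKBmAt (toSite r) Lc (KInvStep (d := d) Lc j))) Lc (unitS sf sm (fun κ v => cE • wilsonA d κ v)) μ u yw.1 y₁ (Sum.inl α) (Sum.inl a) * unitK sf sm (coDressKBmAt (toSite r) Lc (KInvStep (d := d) Lc j)) y₁ z (Sum.inl a) (Sum.inl b)) * vertexOfK (unitK sf sm (coDressKBmAt (toSite r) Lc (KInvStep (d := d) Lc j))) Lc (unitS sf sm (fun κ v => cE • wilsonA d κ v)) ν u' z yw.2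 (Sum.inl b) (Sum.inl β) := by
    intro b
    have hΦ := summable_slot_family (N := Lc) (A := fun y z => (∑' y₁ : Site (d + 1), ∑ a : Fin (d + 1), vertexOfK (unitK sf sm (coDressKBmAt (toSite r) Lc (KInvStep (d := d) Lc j))) Lc (unitS sf sm (fun κ v => cE • wilsonA d κ v)) μ u y y₁ (Sum.inl α) (Sum.inl a) * unitK sf sm (coDressKBmAt (toSite r) Lc (KInvStep (d := d) Lc j)) y₁ z (Sum.inl a) (Sum.inl b))) (Q := fun u' z w => vertexOfK (unitK sf sm (coDressKBmAt (toSite r) Lc (KInvStep (d := d) Lc j))) Lc (unitS sf sm (fun κ v => cE • wilsonA d κ v)) ν u' z w (Sum.inl b) (Sum.inl β))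
      hδ (hAb b) (hQb b) hC2 hCv h₁ h₂
    refine ((hΦ.prod_factor u').prod).congr fun yw => ?_
    show ∑' z : Site (d + 1), (if yw.1 α % (Lc : ℤ) = (Lc : ℤ) - 1 then (1 : ℝ) else 0) * (if yw.2 β % (Lc : ℤ) = (Lc : ℤ) - 1 then (1 : ℝ) else 0) * ((∑' y₁ : Site (d + 1), ∑ a : Fin (d + 1), vertexOfK (unitK sf sm (coDressKBmAt (toSite r) Lc (KInvStep (d := d) Lc j))) Lc (unitS sf sm (fun κ v => cE • wilsonA d κ v)) μ u yw.1 y₁ (Sum.inl α) (Sum.inl a) * unitK sf sm (coDressKBmAt (toSite r) Lc (KInvStep (d := d) Lc j)) y₁ z (Sum.inl a) (Sum.inl b)) * vertexOfK (unitK sf sm (coDressKBmAt (toSite r) Lc (KInvStep (d := d) Lc j))) Lc (unitS sf sm (fun κ v => cE • wilsonA d κ v)) ν u' z yw.2 (Sum.inl b) (Sum.inl β)) = _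
    rw [tsum_mul_left]
  rw [← Summable.tsum_finsetSum (fun b _ => hyw b)]
  refine tsum_congr fun yw => ?_
  rw [comp_comp_vertex_wilson_inl_inl, ← Finset.mul_sum]
  congr 1
  rw [← Summable.tsum_finsetSum (fun b _ => hz b yw.1 yw.2)]
set_option maxHeartbeats 400000 in
/-- [folklore] **THE LITERAL EE INTEGRAND RESUMMED OVER ITS SECOND BOND** (in-block root, `1 ≤ Lc`, level `j`, all units, any directions, fixed first bond `(μ, u)`):
`HasSum (u′ ↦ Σ'_{(y,w)} 𝟙f(y_α)𝟙f(w_β)·((V_{μ,u} ∘ X̃♮_j) ∘ V_{ν,u′}) y w (inl α)(inl β)) (Σ_b Σ'_{(y,z)} 𝟙f(y_α)·A_b(y,z)·Σ'_{(u′,w)} 𝟙f(w_β)·V_{ν,u′} z w (inl b)(inl β))`,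
`A_b(y,z) = Σ'_{y₁} Σ_a V_{μ,u} y y₁ (inl α)(inl a)·X̃♮_j y₁ z (inl a)(inl b)` — `tsum_integrand_eq` ⨾ `ExchangeSlotFubini.hasSum_slot_resum` per field leg `b` ⨾ `hasSum_sum`. -/
theorem hasSum_literal_slot (hLc : 1 ≤ Lc) (hr : r ∈ box (d + 1) Lc) (sf sm cE : ℝ) (j : ℕ) (u : Site (d + 1)) :
    HasSum (fun u' : Site (d + 1) => ∑' yw : Site (d + 1) × Site (d + 1), (if yw.1 α % (Lc : ℤ) = (Lc : ℤ) - 1 then (1 : ℝ) else 0) * (if yw.2 β % (Lc : ℤ) = (Lc : ℤ) - 1 then (1 : ℝ) else 0) *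
        comp (comp (vertexOfK (unitK sf sm (coDressKBmAt (toSite r) Lc (KInvStep (d := d) Lc j))) Lc (unitS sf sm (fun κ v => cE • wilsonA d κ v)) μ u) (unitK sf sm (coDressKBmAt (toSite r) Lc (KInvStep (d := d) Lc j)))) (vertexOfK (unitK sf sm (coDressKBmAt (toSite r) Lc (KInvStep (d := d) Lc j))) Lc (unitS sf sm (fun κ v => cE • wilsonA d κ v)) ν u') yw.1 yw.2 (Sum.inl α) (Sum.inl β))
      (∑ b : Fin (d + 1), ∑' yz : Site (d + 1) × Site (d + 1), (if yz.1 α % (Lc : ℤ) = (Lc : ℤ) - 1 then (1 : ℝ) else 0) * (∑' y₁ : Site (d + 1), ∑ a : Fin (d + 1), vertexOfK (unitK sf sm (coDressKBmAt (toSite r) Lc (KInvStep (d := d) Lc j))) Lc (unitS sf sm (fun κ v => cE • wilsonA d κ v)) μ u yz.1 y₁ (Sum.inl α) (Sum.inl a) * unitK sf sm (coDressKBmAt (toSite r) Lc (KInvStep (d := d) Lc j)) y₁ yz.2 (Sum.inl a) (Sum.inl b)) *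
        ∑' uw : Site (d + 1) × Site (d + 1), (if uw.2 β % (Lc : ℤ) = (Lc : ℤ) - 1 then (1 : ℝ) else 0) * vertexOfK (unitK sf sm (coDressKBmAt (toSite r) Lc (KInvStep (d := d) Lc j))) Lc (unitS sf sm (fun κ v => cE • wilsonA d κ v)) ν uw.1 yz.2 uw.2 (Sum.inl b) (Sum.inl β)) := by
  classical
  obtain ⟨δ, Cv, C2, hδ, hCv, hC2, hVF, hVX⟩ := exists_decay_data (d := d) hLc hr sf sm cE j μ u
  have hAb : ∀ (b : Fin (d + 1)) (y z : Site (d + 1)), |(∑' y₁ : Site (d + 1), ∑ a : Fin (d + 1), vertexOfK (unitK sf sm (coDressKBmAt (toSite r) Lc (KInvStep (d := d) Lc j))) Lc (unitS sf sm (fun κ v => cE • wilsonA d κ v)) μ u y y₁ (Sum.inl α) (Sum.inl a) * unitK sf sm (coDressKBmAt (toSite r) Lc (KInvStep (d := d) Lc j)) y₁ z (Sum.inl a) (Sum.inl b))| ≤ C2 * Real.exp (-δ * (l1 (y - (Lc : ℤ) • u) + l1 (z - (Lc : ℤ) • u))) := by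
    intro b y z
    rw [← comp_vertex_inl_inl]
    exact hVX y z (Sum.inl α) (Sum.inl b)
  have hQb : ∀ (b : Fin (d + 1)) (u' z w : Site (d + 1)), |vertexOfK (unitK sf sm (coDressKBmAt (toSite r) Lc (KInvStep (d := d) Lc j))) Lc (unitS sf sm (fun κ v => cE • wilsonA d κ v)) ν u' z w (Sum.inl b) (Sum.inl β)| ≤
      Cv * Real.exp (-δ * (l1 (z - (Lc : ℤ) • u') + l1 (w - (Lc : ℤ) • u'))) := fun b u' z w => hVF ν u' z w (Sum.inl b) (Sum.inl β)
  have h₁ : ∀ y : Site (d + 1), |(if y α % (Lc : ℤ) = (Lc : ℤ) - 1 then (1 : ℝ) else 0)| ≤ 1 := fun y => by split_ifs <;> simp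
  have h₂ : ∀ w : Site (d + 1), |(if w β % (Lc : ℤ) = (Lc : ℤ) - 1 then (1 : ℝ) else 0)| ≤ 1 := fun w => by split_ifs <;> simp
  have hb : ∀ b : Fin (d + 1), HasSum (fun u' : Site (d + 1) => ∑' yw : Site (d + 1) × Site (d + 1), (if yw.1 α % (Lc : ℤ) = (Lc : ℤ) - 1 then (1 : ℝ) else 0) * (if yw.2 β % (Lc : ℤ) = (Lc : ℤ) - 1 then (1 : ℝ) else 0) *
      ∑' z : Site (d + 1), (∑' y₁ : Site (d + 1), ∑ a : Fin (d + 1), vertexOfK (unitK sf sm (coDressKBmAt (toSite r) Lc (KInvStep (d := d) Lc j))) Lc (unitS sf sm (fun κ v => cE • wilsonA d κ v)) μ u yw.1 y₁ (Sum.inl α) (Sum.inl a) * unitK sf sm (coDressKBmAt (toSite r) Lc (KInvStep (d := d) Lc j)) y₁ z (Sum.inl a) (Sum.inl b)) * vertexOfK (unitK sf sm (coDressKBmAt (toSite r) Lc (KInvStep (d := d) Lc j))) Lc (unitS sf sm (fun κ v => cE • wilsonA d κ v)) ν u' z yw.2 (Sum.inl b) (Sum.inl β))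
      (∑' yz : Site (d + 1) × Site (d + 1), (if yz.1 α % (Lc : ℤ) = (Lc : ℤ) - 1 then (1 : ℝ) else 0) * (∑' y₁ : Site (d + 1), ∑ a : Fin (d + 1), vertexOfK (unitK sf sm (coDressKBmAt (toSite r) Lc (KInvStep (d := d) Lc j))) Lc (unitS sf sm (fun κ v => cE • wilsonA d κ v)) μ u yz.1 y₁ (Sum.inl α) (Sum.inl a) * unitK sf sm (coDressKBmAt (toSite r) Lc (KInvStep (d := d) Lc j)) y₁ yz.2 (Sum.inl a) (Sum.inl b)) *
        ∑' uw : Site (d + 1) × Site (d + 1), (if uw.2 β % (Lc : ℤ) = (Lc : ℤ) - 1 then (1 : ℝ) else 0) * vertexOfK (unitK sf sm (coDressKBmAt (toSite r) Lc (KInvStep (d := d) Lc j))) Lc (unitS sf sm (fun κ v => cE • wilsonA d κ v)) ν uw.1 yz.2 uw.2 (Sum.inl b) (Sum.inl β)) :=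
    fun b => hasSum_slot_resum (N := Lc) (A := fun y z => (∑' y₁ : Site (d + 1), ∑ a : Fin (d + 1), vertexOfK (unitK sf sm (coDressKBmAt (toSite r) Lc (KInvStep (d := d) Lc j))) Lc (unitS sf sm (fun κ v => cE • wilsonA d κ v)) μ u y y₁ (Sum.inl α) (Sum.inl a) * unitK sf sm (coDressKBmAt (toSite r) Lc (KInvStep (d := d) Lc j)) y₁ z (Sum.inl a) (Sum.inl b))) (Q := fun u' z w => vertexOfK (unitK sf sm (coDressKBmAt (toSite r) Lc (KInvStep (d := d) Lc j))) Lc (unitS sf sm (fun κ v => cE • wilsonA d κ v)) ν u' z w (Sum.inl b) (Sum.inl β))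
      hδ (hAb b) (hQb b) hC2 hCv h₁ h₂
  have hsum := hasSum_sum (s := (Finset.univ : Finset (Fin (d + 1)))) (fun b _ => hb b)
  have efun : (fun u' : Site (d + 1) => ∑' yw : Site (d + 1) × Site (d + 1), (if yw.1 α % (Lc : ℤ) = (Lc : ℤ) - 1 then (1 : ℝ) else 0) * (if yw.2 β % (Lc : ℤ) = (Lc : ℤ) - 1 then (1 : ℝ) else 0) *
        comp (comp (vertexOfK (unitK sf sm (coDressKBmAt (toSite r) Lc (KInvStep (d := d) Lc j))) Lc (unitS sf sm (fun κ v => cE • wilsonA d κ v)) μ u) (unitK sf sm (coDressKBmAt (toSite r) Lc (KInvStep (d := d) Lc j)))) (vertexOfK (unitK sf sm (coDressKBmAt (toSite r) Lc (KInvStep (d := d) Lc j))) Lc (unitS sf sm (fun κ v => cE • wilsonA d κ v)) ν u') yw.1 yw.2 (Sum.inl α) (Sum.inl β)) =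
      fun u' => ∑ b ∈ (Finset.univ : Finset (Fin (d + 1))), ∑' yw : Site (d + 1) × Site (d + 1), (if yw.1 α % (Lc : ℤ) = (Lc : ℤ) - 1 then (1 : ℝ) else 0) * (if yw.2 β % (Lc : ℤ) = (Lc : ℤ) - 1 then (1 : ℝ) else 0) *
        ∑' z : Site (d + 1), (∑' y₁ : Site (d + 1), ∑ a : Fin (d + 1), vertexOfK (unitK sf sm (coDressKBmAt (toSite r) Lc (KInvStep (d := d) Lc j))) Lc (unitS sf sm (fun κ v => cE • wilsonA d κ v)) μ u yw.1 y₁ (Sum.inl α) (Sum.inl a) * unitK sf sm (coDressKBmAt (toSite r) Lc (KInvStep (d := d) Lc j)) y₁ z (Sum.inl a) (Sum.inl b)) * vertexOfK (unitK sf sm (coDressKBmAt (toSite r) Lc (KInvStep (d := d) Lc j))) Lc (unitS sf sm (fun κ v => cE • wilsonA d κ v)) ν u' z yw.2 (Sum.inl b) (Sum.inl β) :=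
    funext fun u' => tsum_integrand_eq (μ := μ) (ν := ν) (α := α) (β := β) hLc hr sf sm cE j u u'
  rw [efun]
  exact hsum

end Summit.QuantumFields.BalabanUV.Beta.GAN24.ExchangeSlotLiteral

end
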